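import Mathlib
import HarnessLib
import HarnessLib.Audit
import Summits.QuantumFields.Statement

/-!
Route: GaussianLinkFrames

DORMANT since 2026-09-03T09:43:43Z (reconciler: no traction for 5 d (last activity statement-checked at 2026-08-29T09:02:08Z); parked, not closed — `ledger route dormant route-QuantumFields-GaussianLinkFrames --off` to reactivate) — unstaffed, not closed; items shared with open routes are served there. `ledger route dormant <id> --off` reactivates.

# Route GaussianLinkFrames — condition on the Hubbard–Stratonovich frame — Wilson's weight is a
Gaussian mixture of independent-link laws, so the quark mobility gap is an i.i.d.-disorder problem

It suffices to show X = FRAME ∧ CLOSURE ∧ (the mobility-gap programme's shared trajectory,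
flavour-decay and completion nodes). The NEW
LEVER is an exact disintegration of Wilson's SU(3) measure: two Hubbard–Stratonovich transformations
per plaquette (a Gaussian
"diagonal-link" matrix Φ_p and two Gaussian "folded-link" matrices Ψ_p, Ψ'_p,
VairinhosDeforcrand2014) write exp(β Re tr U_p) as a
POSITIVE Gaussian integral in which every link enters LINEARLY, exp Re tr(U_e J_e(aux)†). Hence,
CONDITIONALLY ON THE FRAME aux, the
links of Wilson's lattice gauge theory are INDEPENDENT, each with an absolutely continuous
tilted-Haar (von Mises–Fisher) law of explicit
tilt J_e; and conditionally on the links the frame is Gaussian, independent across plaquettes. The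
Hermitian Wilson–Dirac kernel
γ₅D_W(U) of lattice QCD is then an Anderson-type operator with genuinely independent, a.c. link
disorder over a frame — the hypothesis
that the tier-A mobility-gap routes name as missing ("no Wegner/FM input for non-abelian Haar
links", "the |det|-tilted law is
non-product: ASFH re-sampling has no independent blocks"). FRAME (FrameAPrioriBound, rank 2): the
Aizenman–Molchanov a-priori
fractional-moment bound for γ₅D_W with independent tilted-Haar SU(3) links, constants polynomial in
the tilt. CLOSURE (FrameFMClosure,
rank 3): FRAME + the disintegration + the ASFH finite-volume criterion turn the one-scale (Lifshitz)
input into clause (ii) of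
WilsonMobilityGap.MobilityGap for every regularisation and mass tuple. The trajectory
(ChiralOneScaleTrajectory), flavour-decay
(PhaseQuenchedFlavourDecay) and completion (ChiralGluonicCompletion) nodes are re-asked VERBATIM
from PauliWegnerSea / WilsonMobilityGap
(shared items stmt-QuantumFields-17512, 9151, 17498), exactly as PauliWegnerSea re-asked
WilsonMobilityGap's downstream. No card realised
(novel-route seat).
Lean: `FrameAPrioriBound ∧ FrameFMClosure ∧ ChiralOneScaleTrajectory ∧ PhaseQuenchedFlavourDecay ∧
ChiralGluonicCompletion`

## Assembly
Pure logic, the PauliWegnerSea shape: ChiralOneScaleTrajectory gives, for N_f = 2, 3, ONE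
chiral-at-zero regularisation with (i), the
one-scale input, (iii), (iv) for every m > 0; FrameFMClosure fed FrameAPrioriBound turns the
one-scale input into clause (ii);
PhaseQuenchedFlavourDecay turns (ii) into flavour-charged decay; ChiralGluonicCompletion consumes
(i)–(iv) + decay and returns QCDOf N_f;
QCD = QCDOf 2 ∧ QCDOf 3. The deciding theorem `closes` (glue.lean) elaborates in Sketch.lean; the
supports are tools for the provers of
FrameFMClosure and are not binders.

Rationale: WHY THIS LINE. Random-operator proofs of localisation (AizenmanMolchanov1993, AizenmanEtAl2001,
AizenmanWarzel2015) consume exactly two structural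
hypotheses — independence of the local random variables and regularity of their single-site
conditional laws — and both FAIL for the
Gibbs-correlated Haar links of e^(−βS_W): WilsonMobilityGap conditions nothing and PauliWegnerSea
manufactures a substitute on two-star
fibres (its TiltedFlatness was refuted once before repair). The Hubbard–Stratonovich representation
of VairinhosDeforcrand2014 (built for
Monte Carlo, never used rigorously) supplies BOTH hypotheses exactly and at every β: Wilson(β) =
E_aux[⊗_e ν_{J_e(aux)}], ν_J(dU) ∝
e^(Re tr UJ†) dU, with aux | U Gaussian and plaquette-wise independent, so frame tails are explicit
and bad-frame regions are sparse
without touching the Yang–Mills-hard law of the frame. Imported: Hubbard–Stratonovich auxiliary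
fields (statistical field theory),
fractional-moment localisation with matrix-valued single-site randomness (ErdosHasler2012 for U(1)
flux, PeledEtAl2017 and
doi:10.4171/jems/451 for non-monotone/orbital models), harmonic analysis of one-link integrals
(Creutz2022). What no listed route does:
make the gauge field CONDITIONALLY I.I.D.; the negatives index (4 entries) contains nothing of this
shape.

RANKED CRUXES. #2 FrameAPrioriBound (crux) — Aizenman–Molchanov a-priori bound in the frame: there
are s ∈ (0,1), C, p such that on every torus (ℤ/L)⁴, L ≥ 4, for every bare mass m₀ ∈ [−2,2], every
tilt field J : edges → M₃(ℂ) with entries ≤ B, every z with Im z ≠ 0, |z| ≤ 1 and all sites x, y,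
the expectation under the PRODUCT tilted-Haar law ⊗_e e^(Re tr U_eJ_e†)dU_e (normalised) of
(Σ_colour,spin |(γ₅D_W(U;m₀,r=1) − z)⁻¹(x·,y·)|)^s is ≤ C(1+B)^p — uniformly in L, z, x, y and the
tilt direction. [difficulty: L] (why it might fail: Off-diagonal, rank-24, non-monotone SU(3) link
disorder: no Boole/weak-L¹ lemma in print beyond rank-one alloy or U(1) flux (ErdosHasler2012); a
two-star fibre where det(H−z) degenerates as Im z→0 could blow C up; (1+B)^p may be too weak at
sharp tilts.) [AizenmanMolchanov1993, AizenmanEtAl2001, ErdosHasler2012, PeledEtAl2017,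
doi:10.4171/jems/451, VairinhosDeforcrand2014]
#3 FrameFMClosure (crux) — the closure: FrameAPrioriBound ⇒ for every N_f, every regularisation reg
and every positive mass tuple m, IF the one-scale input of the mobility-gap programme holds (a
log-scale shell ℓ₀ with polynomial room carries E_|w|[(Σ|G_f(0,v)|)^s] ≤ 1, verbatim the antecedent
of PauliWegnerSea.FMClosureUnquenched), THEN clause (ii) of WilsonMobilityGap.MobilityGap holds:
phase-quenched fractional moments of the flavour-f quark propagator decay like C e^(−δ a_k |v|) for
all large k, all tori S ≥ L_k. Mechanism: disintegrate the Wilson factor into independent-link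
frames (PlaquetteGaussianFrame), run the ASFH finite-volume criterion CONDITIONALLY on the frame
with FrameAPrioriBound as a-priori/decoupling input and the |Πdet| Pauli tilt handled by single-link
flatness (PauliWegnerSea.SingleLink(Log)Flatness, proved), then average over frames, splitting
good/bad frames by Markov and bounding bad-frame regions by the Gaussian law of aux given U. [deps:
FrameAPrioriBound] [difficulty: L] (why it might fail: The |Πdet| tilt re-couples links given the
frame (product only up to a bounded-degree weight); tilts are unbounded over S ≥ L_k tori, so ASFH
constants must be localised and bad-frame regions shown sparse via Gaussian tails of aux given U — a
percolation step not in print.) [AizenmanEtAl2001, AizenmanWarzel2015, VairinhosDeforcrand2014,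
GoltermanShamir2003]
#4 ChiralOneScaleTrajectory (crux) — shared verbatim with PauliWegnerSea (stmt-QuantumFields-17512):
for N_f ∈ {2,3} ONE mass-independent regularisation with HasMassScaling, IsChiralAtZero and two-loop
asymptotic scaling such that for every m > 0: (i) bare masses eventually > −1; (one-scale) the
log-scale shell input; (iii) the lower bound on the phase-quenched propagator moment (quarks not
lattice-heavy); (iv) sign coherence at the scheme's own side. [difficulty: open-problem] (why it
might fail: Adds Goldstone gaplessness of the SIGNED theory as m→0⁺ at the witness's own m_crit(k)
(volume-uniform pion lower bound, none in tree) on top of the open one-scale/Lifshitz input and sign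
coherence (iv) for N_f=3; false if physical-rate localisation holds only strictly above the chiral
line.) [GoltermanShamir2003, SharpeSingleton1998, EdwardsHellerNarayanan1998, Luscher1977,
MontvayMunster1994, JaffeWitten2000]
#5 PhaseQuenchedFlavourDecay (crux) — shared verbatim with WilsonMobilityGap/PauliWegnerSea
(stmt-QuantumFields-9151): for every N_f, reg, m > 0, clause (ii) alone implies volume-uniform
exponential decay at rate δ' a_k of the phase-quenched connected correlator of every FLAVOUR-CHARGED
gauge-invariant local lattice observable pair. [deps: FrameFMClosure] [difficulty: L] (why it might
fail: (ii) gives s<1 single-entry moments; the conclusion needs volume-uniform FIRST moments of r×r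
minors of G_f (r≥2: baryons) under the |Πdet| weight: a Minami-type bound plus an
eigenfunction-correlator step — frames make the disorder conditionally independent, but the minors
step is unproved.) [Weingarten1983, VafaWitten1984NPB, SimsWarzel2016, AizenmanWarzel2015,
Minami1996, MontvayMunster1994]
#6 ChiralGluonicCompletion (crux) — shared verbatim with WilsonMobilityGap/PauliWegnerSea
(stmt-QuantumFields-17498): for N_f ∈ {2,3}, a chiral-at-zero regularisation carrying clauses
(i)–(iv) and the flavour-charged phase-quenched decay for every m > 0 can be completed to QCDOf N_f
(signed weight, flavour-neutral and gluonic channels, continuum limit). [deps: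
PhaseQuenchedFlavourDecay] [difficulty: open-problem] (why it might fail: Contains the Yang–Mills
gap: sign coherence only at side 2L_k+1 while HasLatticeMassGap needs all S ≥ L_k ⇒ a convergent
sign-defect expansion = uniform gluonic clustering at weak coupling, open; plus E0–E4 and
non-Gaussian glue. The frame disintegration does not touch this node.) [JaffeWitten2000,
Balaban1988Convergent, OsterwalderSeiler1978, Luscher1977, MohlerSchaefer2020, SeilerLNP1982]
#9 PlaquetteGaussianFrame (support) — the one-plaquette Hubbard–Stratonovich identity behind the
lever (provable now: three Gaussian integrals over M₃(ℂ) ≅ ℝ¹⁸, completing squares and ‖A‖² = 3 for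
A ∈ SU(3)): for every β ≥ 0 there is K(β) > 0 with exp(β Re tr(U_aU_bU_c⁻¹U_d⁻¹)) = K ∫dΦ dΨ dΨ'
exp(−(1+2t)‖Φ‖² − ‖Ψ‖² − ‖Ψ'‖² + 2c[Re tr(Ψ†U_a) + Re tr(U_bΦΨ) + Re tr(U_cΦΨ') + Re tr(Ψ'†U_d)]), t
= √(β/2), c = √t, for all U_a,…,U_d ∈ SU(3) — every link linear, every exponent real. Over the torus
(Fubini) this makes Wilson(β) the aux-mixture of the product laws ⊗_e ν_(J_e(aux)), J_e a sum over
the 6 plaquettes through e of 2cΨ, 2c(ΦΨ)†, …. [difficulty: provable-now] [VairinhosDeforcrand2014,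
Creutz2022]
#9 TiltedHaarFlatness (support) — single-link flatness of the tilted-Haar (von Mises–Fisher) law
(provable now, Laplace lower bound on SU(3) via Haar small balls): there are C, p with e^(Re tr
U₀J†) ≤ C(1+B)^p ∫ e^(Re tr UJ†) dHaar(U) for every J with entries ≤ B and every U₀ ∈ SU(3) — the
density of ν_J w.r.t. Haar is at most polynomial in the tilt, which is what makes the frame's
single-link laws "regular" in the sense of the fractional-moment method with constants (1+B)^p.
[difficulty: provable-now] [VairinhosDeforcrand2014, Creutz2022, AizenmanMolchanov1993]

TWO-LAYER PLAN. FrameAPrioriBound ⇐ StarSchurReduction (G_xy as a block of the inverse of a 24×24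
Schur complement that is a matrix-QUADRATIC polynomial
in the 16 star links) → StarFibreSmallBall (Remez/Łojasiewicz small-ball bound for its determinant
under product tilted Haar, via
TiltedHaarFlatness + PauliWegnerSea.SingleLinkLogFlatness) → FrameAPrioriBound. FrameFMClosure ⇐
ConditionalASFH (the finite-volume
criterion under ⊗ν_J × |Πdet| with frame-local constants) → FrameTailGivenLinks (Gaussian-chaos
tails of J_e given U, plaquette-wise
independent) → FrameFMClosure. Nothing filed now.

KILL CRITERIA. Refutation of FrameAPrioriBound (a torus, mass, tilt field and z-sequence with
exploding product-law fractional moment at fixed B) closes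
the route outright (close --reason refuted:FrameAPrioriBound) — and is a reusable negative fact
about unitary link disorder. Refutation of
PlaquetteGaussianFrame (the identity) kills the lever itself (it is a finite-dimensional Gaussian
computation: a sign or normalisation
error would be repaired, a structural failure closes the route). A refutation of the shared
ChiralOneScaleTrajectory or
ChiralGluonicCompletion breaks this route together with WilsonMobilityGap/PauliWegnerSea (repair
follows theirs). If
PauliWegnerSea.FMClosureUnquenched is PROVED first, this route is superseded for clause (ii) (close
--reason superseded) unless
FrameAPrioriBound is wanted elsewhere.

NOT DECOMPOSED YET. The decoupling lemma companion of FrameAPrioriBound (two-resolvent fractional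
moments), the localisation of ASFH constants in frame-bad
regions, the explicit tilt map J_e(aux) over the torus (six plaquettes per link, orientation
bookkeeping) and the Fubini/absolute
convergence of the torus-wide disintegration are layer-2 children; so are the Wegner and Minami
estimates under product tilted laws that
PhaseQuenchedFlavourDecay's minors step will want. Constants s, p are left existential on purpose
(typing checklist 4c(iv)).

CHEAPEST FALSIFIER. (1) Numerically integrate the one-plaquette identity for SU(2)/SU(3) at β = 0.5,
2, 6 with random links (a 54-real-dimensional Gaussian
Monte Carlo vs the closed form; minutes) — any mismatch beyond normalisation kills the lever. (2)
Sample INDEPENDENT tilted-Haar links on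
an 8⁴ torus at tilts B ∈ {0, 1, 4, 16, 64} (aligned frame), compute E[(Σ|G_z(x,y)|)^s] for γ₅D_W at
m₀ ∈ {−1, −0.5, 0}, Im z = 10⁻³…10⁻⁶:
growth faster than polynomial in B or divergence as Im z → 0 kills FrameAPrioriBound. Not run this
cycle (kit not in this seat's
budget line); both are one batched kit job for the first refuter.

NUMBERS. Disorder strength given the frame: ν_J concentrates within angle ≍ ‖J‖^(−1/2) of polar(J);
typical ‖J_e‖ ≍ β at weak coupling (aux |
U Gaussian with mean ≍ √β), i.e. conditional link noise ≍ g = β^(−1/2) — the physical size of gauge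
fluctuations. Tilted density w.r.t.
Haar ≤ C(1+B)^4 expected (Laplace on the 8-dimensional SU(3)). Hopping-expansion radius κ < 1/8
(HoppingExpansionLocality) is never used.
WegnerEstimate (stmt-QuantumFields-8966) asks DOS ≤ C(1+β^p)εL⁴ — the same polynomial-in-β budget as
(1+B)^p here with B ≍ β.

DEFINITION REQUESTS. None needed at open: the tilted product law, the resolvent and the Gaussian
frame are typed inline over `wilsonDirac`, `spinorLift gammaFive`,
`haarProbability`, `Matrix.of`. If FrameFMClosure's provers want it: `ledger workitem add --kind
definition --notion tiltedHaarLaw --topic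
Literature/MathematicalPhysics/QuantumLattice` (ν_J as a probability measure on SU(3)) and `--notion
gaussianLinkFrame` (the torus-wide aux
space, its Gaussian law given U and the tilt map J_e).

Novelty: Searches (2026-08-17): lit search --source s2/zbmath/crossref "lattice gauge theory without link
variables" (VdF 2014 + 2015 proceedings, 21 citations, none rigorous); lit search --source crossref
"Wegner estimate random magnetic field lattice" (ErdosHasler CMP 2011 / AHP 2012, Ueki 2012,
Hasler–Luckett 2013 — all U(1)); "Wegner orbital model" (PeledEtAl2017,
Aizenman–Peled–Schenker–Shamis–Sodin 2017); lit galaxy search "lattice gauge theory without link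
variables" --star all (0 rows); local hybrid "Hubbard-Stratonovich transformation lattice gauge
theory auxiliary field" (textbooks only); tree grep of QCD/YangMills Ideas+Theses for
Stratonovich/Vairinhos/Zirnbauer (hits: YangMills cards howe-dual-* = integrate-out-links duals,
closed falsified/variant; the gluon-free-monotone-dual audit citing VdF;
MultibosonBridge/GluonFreeDual theses) — no route or card CONDITIONS on the auxiliary field.
openalex/arxiv rate-limited this session (logged).
Nearest prior art found: VairinhosDeforcrand2014 (arXiv:1409.8442: the HS identity, "1-link action",
effective links; Monte Carlo use only); route-QuantumFields-PauliWegnerSea (two-star conditional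
laws as the substitute for independence); route-QuantumFields-RandomConstraintAnnealing (YangMills:
Edwards–Sokal disintegration of Wilson into Haar-on-a-tube — non-product fibres); ErdosHasler2012
(Wegner/localisation for INDEPENDENT U(1) link fluxes).
Delta: [summit-strength-explained:ChiralGluonicCompletion — the shared completion node is a c  [refs: 1409.8442, PeledEtAl2017, VairinhosDeforcrand2014, ErdosHasler2012]

Barriers (technique_class: hs-disintegration, random-operator-localisation): - technique_class: hs-disintegration, random-operator-localisation, fractional-moments
- Literature.Barriers.QuantumFields.HoppingExpansionUniformGap: no expansion in κ anywhere; decay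
rates δ·a_k come from the one-scale (Lifshitz) input in physical units, so κ → κ_c(β) > 1/8 is
allowed — the barrier's disc is never entered.
- Literature.Barriers.QuantumFields.HoppingExpansionLocality: same — locality is produced by
fractional-moment localisation at the physical mass, not by a convergent Neumann series; the ℓ² disc
K < 1/8 is irrelevant.
- Literature.Barriers.QuantumFields.WilsonDeterminantSign: all frame statements are under the
PHASE-QUENCHED |Πdet| weight (as in WilsonMobilityGap); the sign is clause (iv) of the shared
trajectory crux and the completion's reweighting; the HS identity is sign-agnostic (it disintegrates
the gauge factor only).
- Literature.Barriers.QuantumFields.WilsonDeterminantMassSplitting: split masses enter only through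
|Πdet D_W(m_f(k))|, flavour by flavour; no positivity of the signed split weight is claimed.
- Literature.Barriers.QuantumFields.BanksCasherCriterion: the decay rate δ(m) may vanish as m → 0⁺
and IsChiralAtZero is carried by the shared trajectory crux; no uniform ‖D_W⁻¹‖ bound is asserted —
only fractional moments s < 1.
- Literature.Barriers.QuantumFields.VafaWittenEigenvalueBound: consistent — near-zero modes of γ₅D_W
are allowed (they are what fractional moments average over); nothing bounds the smallest eigenvalue
configuration-wise.

History (route lifecycle, newest last):
- 2026-08-26T05:05:19Z · DORMANT — reconciler: no traction for 8.4 d (last activity item-evidence-added at 2026-08-17T19:45:08Z); parked, not closed — `ledger route dormant route-QuantumFields-Ga (operator:999:2015198)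
- 2026-08-28T21:17:31Z · REACTIVATED — reconciler: reactivated — activity statement-closed at 2026-08-28T18:39:30Z after parking at 2026-08-26T05:05:19Z (operator:999:2493182)
- 2026-09-03T09:43:43Z · DORMANT — reconciler: no traction for 5 d (last activity statement-checked at 2026-08-29T09:02:08Z); parked, not closed — `ledger route dormant route-QuantumFields-Gaussi (operator:999:3943968)

sub-problem: QCD · status: dormant · opened planner-plan-novel-QuantumFields-QCD-829546d5-v2-g18-0 2026-08-17T01:53:25Z · rev 2 · ledger route-QuantumFields-GaussianLinkFrames
GENERATED by the gate from the ledger (D-0016/17). Provers cite these decls: `theorem foo : Summit.QuantumFields.QCD.Theses.GaussianLinkFrames.<Decl> := …` in Summits/QuantumFields/QCD/Theorems/<Name>.lean.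
-/

namespace Summit.QuantumFields.QCD.Theses.GaussianLinkFrames

open scoped BigOperators Topology Manifold Classical MeasureTheory ProbabilityTheory Matrix InnerProductSpace ComplexConjugate ContinuousMap
open Filter Set Function TopologicalSpace MeasureTheory

attribute [summit_statement] _root_.QCD

/-- item stmt-QuantumFields-17374 · crux · rank 2 · open · by planner
why it might fail: Off-diagonal, rank-24, non-monotone SU(3) link disorder: no Boole/weak-L¹ lemma in print beyond rank-one alloy or U(1) flux (ErdosHasler2012); a two-star fibre where det(H−z) degenerates as Im z→0 could blow C up; (1+B)^p may be too weak at sharp tilts.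
sources: AizenmanMolchanov1993, AizenmanEtAl2001, ErdosHasler2012, PeledEtAl2017, doi:10.4171/jems/451, VairinhosDeforcrand2014
[crux] Aizenman–Molchanov a-priori bound in the frame: there are s ∈ (0,1), C, p such that on every
torus (ℤ/L)⁴, L ≥ 4, for every bare mass m₀ ∈ [−2,2], every tilt field J : edges → M₃(ℂ) with
entries ≤ B, every z with Im z ≠ 0, |z| ≤ 1 and all sites x, y, the expectation under the PRODUCT
tilted-Haar law ⊗_e e^(Re tr U_eJ_e†)dU_e (normalised) of (Σ_colour,spin |(γ₅D_W(U;m₀,r=1) −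
z)⁻¹(x·,y·)|)^s is ≤ C(1+B)^p — uniformly in L, z, x, y and the tilt direction. [difficulty: L] -/
@[route_item "route-QuantumFields-GaussianLinkFrames"]
def FrameAPrioriBound : Prop :=
  open MeasureTheory Filter Literature.MathematicalPhysics.QuantumFieldTheory Literature.MathematicalPhysics.QuantumLattice Literature.Probability.LatticeModels in ∃ s C p : ℝ, 0 < s ∧ s < 1 ∧ 0 < C ∧ ∀ (L : ℕ) [NeZero L], 4 ≤ L → ∀ m₀ : ℝ, -2 ≤ m₀ → m₀ ≤ 2 → ∀ B : ℝ, 0 ≤ B → ∀ J : Edge 4 L → Matrix (Fin 3) (Fin 3) ℂ, (∀ e i j, ‖J e i j‖ ≤ B) → ∀ z : ℂ, z.im ≠ 0 → ‖z‖ ≤ 1 → ∀ x y : TorusSite 4 L, let haar : Measure (GaugeConfig 4 L (Matrix.specialUnitaryGroup (Fin 3) ℂ)) := Measure.pi fun _ => haarProbability (Matrix.specialUnitaryGroup (Fin 3) ℂ); let wt : GaugeConfig 4 L (Matrix.specialUnitaryGroup (Fin 3) ℂ) → ℝ := fun U => Real.exp (∑ e : Edge 4 L, (((U e : Matrix.specialUnitaryGroup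 (Fin 3) ℂ) : Matrix (Fin 3) (Fin 3) ℂ) * (J e)ᴴ).trace.re); let R : GaugeConfig 4 L (Matrix.specialUnitaryGroup (Fin 3) ℂ) → Matrix (TorusSite 4 L × Fin 3 × Fin 4) (TorusSite 4 L × Fin 3 × Fin 4) ℂ := fun U => (spinorLift gammaFive * wilsonDirac (fundamentalRep (Fin 3)) U m₀ 1 - z • (1 : Matrix (TorusSite 4 L × Fin 3 × Fin 4) (TorusSite 4 L × Fin 3 × Fin 4) ℂ))⁻¹; (∫ U, (∑ a : Fin 3, ∑ i : Fin 4, ∑ b : Fin 3, ∑ j : Fin 4, ‖R U (x, a, i) (y, b, j)‖) ^ s * wt U ∂haar) / (∫ U, wt U ∂haar) ≤ C * (1 + B) ^ p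

/-- item stmt-QuantumFields-17375 · crux · rank 3 · open · by planner
why it might fail: The |Πdet| tilt re-couples links given the frame (product only up to a bounded-degree weight); tilts are unbounded over S ≥ L_k tori, so ASFH constants must be localised and bad-frame regions shown sparse via Gaussian tails of aux given U — a percolation step not in print.
sources: AizenmanEtAl2001, AizenmanWarzel2015, VairinhosDeforcrand2014, GoltermanShamir2003
[crux] the closure: FrameAPrioriBound ⇒ for every N_f, every regularisation reg and every positive
mass tuple m, IF the one-scale input of the mobility-gap programme holds (a log-scale shell ℓ₀ with
polynomial room carries E_|w|[(Σ|G_f(0,v)|)^s] ≤ 1, verbatim the antecedent of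
PauliWegnerSea.FMClosureUnquenched), THEN clause (ii) of WilsonMobilityGap.MobilityGap holds:
phase-quenched fractional moments of the flavour-f quark propagator decay like C e^(−δ a_k |v|) for
all large k, all tori S ≥ L_k. Mechanism: disintegrate the Wilson factor into independent-link
frames (PlaquetteGaussianFrame), run the ASFH finite-volume criterion CONDITIONALLY on the frame
with FrameAPrioriBound as a-priori/decoupling input and the |Πdet| Pauli tilt handled by single-link
flatness (PauliWegnerSea.SingleLink(Log)Flatness, proved), then average over frames, splitting
good/bad frames by Markov and bounding bad-frame regions by the Gaussian law of aux given U. [deps: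
FrameAPrioriBound] [difficulty: L] -/
@[route_item "route-QuantumFields-GaussianLinkFrames"]
def FrameFMClosure : Prop :=
  open MeasureTheory Filter Literature.MathematicalPhysics.QuantumFieldTheory Literature.MathematicalPhysics.QuantumLattice Literature.Probability.LatticeModels in FrameAPrioriBound → ∀ (Nf : ℕ) (reg : QCDRegularisation Nf) (m : Fin Nf → ℝ), (∀ f, 0 < m f) → (∀ q : ℕ, ∃ K₀ s : ℝ, 0 < s ∧ s < 1 ∧ ∀ᶠ k in atTop, ∃ ℓ₀ : ℕ, 1 ≤ ℓ₀ ∧ ℓ₀ ≤ reg.L k ∧ (ℓ₀ : ℝ) * reg.a k ≤ K₀ * (1 + |Real.log (reg.a k)|) ∧ ∀ S : ℕ, reg.L k ≤ S → ∀ (f : Fin Nf) (v : Literature.Probability.LatticeModels.Site 4), v ∈ box 4 S → ‖v‖ = (ℓ₀ : ℝ) → (ℓ₀ : ℝ) ^ q * (1 + |reg.β k|) ^ q * ((∫ U : GaugeConfig 4 (2 * S + 1) (Matrix.specialUnitaryGroup (Fin 3) ℂ), ‖(diracMatrix U fun fl => reg.mcrit k + reg.a k * m fl / reg.Zm k).det‖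 * (∑ a : Fin 3, ∑ i : Fin 4, ∑ b : Fin 3, ∑ j : Fin 4, ‖(diracMatrix U fun fl => reg.mcrit k + reg.a k * m fl / reg.Zm k)⁻¹ (quarkEquiv (f, (Torus.proj (2 * S + 1) 0, a, i))) (quarkEquiv (f, (Torus.proj (2 * S + 1) (v), b, j)))‖) ^ s ∂(wilsonMeasure (fundamentalRep (Fin 3)) (reg.β k))) / (∫ U : GaugeConfig 4 (2 * S + 1) (Matrix.specialUnitaryGroup (Fin 3) ℂ), ‖(diracMatrix U fun fl => reg.mcrit k + reg.a k * m fl / reg.Zm k).det‖ ∂(wilsonMeasure (fundamentalRep (Fin 3)) (reg.β k)))) ≤ 1) → (∃ s δ C : ℝ, 0 < s ∧ s < 1 ∧ 0 < δ ∧ ∀ᶠ k in atTop, ∀ S : ℕ, reg.L k ≤ S → ∀ (f : Fin Nf) (v : Literature.Probability.LatticeModels.Site 4), v ∈ box 4 S → (∫ U : GaugeConfig 4 (2 * S + 1) (Matrix.specialUnitaryGroup (Fin 3) ℂ), ‖(diracMatrix U fun fl => reg.mcrit k + reg.a k * m fl / reg.Zm k).det‖ * (∑ a : Fin 3, ∑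 i : Fin 4, ∑ b : Fin 3, ∑ j : Fin 4, ‖(diracMatrix U fun fl => reg.mcrit k + reg.a k * m fl / reg.Zm k)⁻¹ (quarkEquiv (f, (Torus.proj (2 * S + 1) 0, a, i))) (quarkEquiv (f, (Torus.proj (2 * S + 1) (v), b, j)))‖) ^ s ∂(wilsonMeasure (fundamentalRep (Fin 3)) (reg.β k))) / (∫ U : GaugeConfig 4 (2 * S + 1) (Matrix.specialUnitaryGroup (Fin 3) ℂ), ‖(diracMatrix U fun fl => reg.mcrit k + reg.a k * m fl / reg.Zm k).det‖ ∂(wilsonMeasure (fundamentalRep (Fin 3)) (reg.β k))) ≤ C * Real.exp (-(δ * (reg.a k * ‖v‖))))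

/-- item stmt-QuantumFields-17512 · crux · rank 4 · open · by planner
why it might fail: Adds Goldstone gaplessness of the SIGNED theory as m→0⁺ at the witness's own m_crit(k) (volume-uniform pion lower bound, none in tree) on top of the open one-scale/Lifshitz input and sign coherence (iv) for N_f=3; false if physical-rate localisation holds only strictly above the chiral line.
sources: GoltermanShamir2003, SharpeSingleton1998, EdwardsHellerNarayanan1998, Luscher1977, MontvayMunster1994, JaffeWitten2000
[crux] the consumer's half after the statement re-type of 2026-08-16 (p117723: `QCDOf` gained
`reg.IsChiralAtZero`): = OneScaleTrajectory (stmt-QuantumFields-11513, now support; clauses (i),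
one-scale, (iii), (iv) verbatim) with the SAME regularisation additionally CHIRAL AT ZERO —
`reg.IsChiralAtZero`: for every ε > 0 some positive mass tuple m has ¬(reg.scheme m 0
0).HasLatticeMassGap ε, i.e. the honest signed lattice gap closes as m → 0⁺, which pins the
flavour-blind additive offset of m_crit(k) to the chiral point (the up-shift symmetry m_crit ↦
m_crit + a_k M₀/Z_m behind `qcdOf_iff_threshold` is gone). For N_f ∈ {2,3} there is reg :
QCDRegularisation N_f with HasMassScaling, IsChiralAtZero and two-loop asymptotic scaling such that
for every m > 0, along m_f(k) = m_crit(k) + a_k m_f/Z_m(k): (i) −1 < m_f(k) eventually; (one-scale)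
∀ q ∃ K₀, s ∈ (0,1): eventually in k some shell ℓ₀ ≤ L_k, ℓ₀ a_k ≤ K₀(1+|log a_k|), carries
ℓ₀^q(1+|β_k|)^q E_{|w|,k,S}[(Σ|G_f(0,v)|)^s] ≤ 1 for all S ≥ L_k, f, ‖v‖∞ = ℓ₀; (iii) the LOWER
bound c₀ e^(−C₁ a_k n − p log(n+1)) ≤ E_{|w|,k,S}[(Σ|G_f(0,n e₀)|)^s]; (iv) SIGN coherence ½ ≤
|∫det|/∫|det| at side 2L_k+1. The chirality conjunct cannot be a separa -/
@[route_item "route-QuantumFields-GaussianLinkFrames"]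
def ChiralOneScaleTrajectory : Prop :=
  open MeasureTheory Filter Literature.MathematicalPhysics.QuantumFieldTheory Literature.MathematicalPhysics.QuantumLattice Literature.Probability.LatticeModels in ∀ Nf : ℕ, Nf = 2 ∨ Nf = 3 → ∃ reg : QCDRegularisation Nf, reg.HasMassScaling ∧ reg.IsChiralAtZero ∧ (reg.scheme 0 0 0).HasAsymptoticScaling ∧ ∀ m : Fin Nf → ℝ, (∀ f, 0 < m f) → (∀ f : Fin Nf, ∀ᶠ k in atTop, -1 < reg.mcrit k + reg.a k * m f / reg.Zm k) ∧ (∀ q : ℕ, ∃ K₀ s : ℝ, 0 < s ∧ s < 1 ∧ ∀ᶠ k in atTop, ∃ ℓ₀ : ℕ, 1 ≤ ℓ₀ ∧ ℓ₀ ≤ reg.L k ∧ (ℓ₀ : ℝ) * reg.a k ≤ K₀ * (1 + |Real.log (reg.a k)|) ∧ ∀ S : ℕ, reg.L k ≤ S → ∀ (f : Fin Nf) (v : Literature.Probability.LatticeModels.Site 4), v ∈ box 4 S → ‖v‖ = (ℓ₀ : ℝ) → (ℓ₀ : ℝ) ^ q * (1 + |reg.β k|) ^ q * ((∫ U : GaugeConfig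 4 (2 * S + 1) (Matrix.specialUnitaryGroup (Fin 3) ℂ), ‖(diracMatrix U fun fl => reg.mcrit k + reg.a k * m fl / reg.Zm k).det‖ * (∑ a : Fin 3, ∑ i : Fin 4, ∑ b : Fin 3, ∑ j : Fin 4, ‖(diracMatrix U fun fl => reg.mcrit k + reg.a k * m fl / reg.Zm k)⁻¹ (quarkEquiv (f, (Torus.proj (2 * S + 1) 0, a, i))) (quarkEquiv (f, (Torus.proj (2 * S + 1) (v), b, j)))‖) ^ s ∂(wilsonMeasure (fundamentalRep (Fin 3)) (reg.β k))) / (∫ U : GaugeConfig 4 (2 * S + 1) (Matrix.specialUnitaryGroup (Fin 3) ℂ), ‖(diracMatrix U fun fl => reg.mcrit k + reg.a k * m fl / reg.Zm k).det‖ ∂(wilsonMeasure (fundamentalRep (Fin 3)) (reg.β k)))) ≤ 1) ∧ (∃ s c₀ C₁ p : ℝ, 0 < s ∧ s < 1 ∧ 0 < c₀ ∧ ∀ᶠ k in atTop, ∀ S : ℕ, reg.L k ≤ S → ∀ (f : Fin Nf) (n : ℕ), n ≤ S → c₀ * Real.exp (-(C₁ * (reg.a k * n) + p * Real.log (n + 1)))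 ≤ (∫ U : GaugeConfig 4 (2 * S + 1) (Matrix.specialUnitaryGroup (Fin 3) ℂ), ‖(diracMatrix U fun fl => reg.mcrit k + reg.a k * m fl / reg.Zm k).det‖ * (∑ a : Fin 3, ∑ i : Fin 4, ∑ b : Fin 3, ∑ j : Fin 4, ‖(diracMatrix U fun fl => reg.mcrit k + reg.a k * m fl / reg.Zm k)⁻¹ (quarkEquiv (f, (Torus.proj (2 * S + 1) 0, a, i))) (quarkEquiv (f, (Torus.proj (2 * S + 1) (Pi.single 0 (n : ℤ)), b, j)))‖) ^ s ∂(wilsonMeasure (fundamentalRep (Fin 3)) (reg.β k))) / (∫ U : GaugeConfig 4 (2 * S + 1) (Matrix.specialUnitaryGroup (Fin 3) ℂ), ‖(diracMatrix U fun fl => reg.mcrit k + reg.a k * m fl / reg.Zm k).det‖ ∂(wilsonMeasure (fundamentalRep (Fin 3)) (reg.β k)))) ∧ (∀ᶠ k in atTop, (1 / 2 : ℝ) ≤ ‖∫ U : GaugeConfig 4 (2 * reg.L k + 1) (Matrix.specialUnitaryGroup (Fin 3) ℂ), (diracMatrix U fun fl => reg.mcrit k + reg.a k * m fl / reg.Zm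 k).det ∂(wilsonMeasure (fundamentalRep (Fin 3)) (reg.β k))‖ / (∫ U : GaugeConfig 4 (2 * reg.L k + 1) (Matrix.specialUnitaryGroup (Fin 3) ℂ), ‖(diracMatrix U fun fl => reg.mcrit k + reg.a k * m fl / reg.Zm k).det‖ ∂(wilsonMeasure (fundamentalRep (Fin 3)) (reg.β k))))

/-- item stmt-QuantumFields-9151 · crux · rank 5 · open · by planner
why it might fail: (ii) gives s<1 single-entry moments; the conclusion needs volume-uniform FIRST moments of r×r minors of G_f (r≥2: baryons) under the |Πdet| weight: a Minami-type bound plus an eigenfunction-correlator step — frames make the disorder conditionally independent, but the minors step is unproved.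
sources: Weingarten1983, VafaWitten1984NPB, SimsWarzel2016, AizenmanWarzel2015, Minami1996, MontvayMunster1994
[crux] card K2, phase-quenched and determinantal. For every N_f, every reg : QCDRegularisation N_f
and every m > 0: the UPPER clause of MobilityGap alone implies that there is δ' > 0 such that for
every pair of gauge-invariant local lattice QCD observables A, B (any quark boxes) with A
FLAVOUR-CHARGED (some flavour f₀ and q ≠ 0 with A ↦ e^(iqθ)A under ψ_f₀ ↦ e^(iθ)ψ_f₀, ψ̄_f₀ ↦
e^(−iθ)ψ̄_f₀) there is C' with, for all large k, all S ≥ L_k and n ≤ S, |E_{|w|}[⟨A(0)·B(n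
e₀)⟩_F(U)]| ≤ C' e^(−δ' a_k n), ⟨·⟩_F(U) the Berezin ratio in the background U (charged A has ⟨A⟩_F
≡ 0, so this IS the connected correlator of the phase-quenched ensemble). Mechanism: Wick's theorem
in determinant form — ⟨AB⟩_F·Π_f det D_f is a sum of products of COMPLEMENTARY MINORS of the D_f
(Jacobi), bounded configuration-wise, and flavour charge forces ≥ |q| quark lines of flavour f₀
across the separation in every term; the upgrade from single-entry s<1 moments to first moments of
minors is the lattice analogue of the eigenfunction-correlator / determinantal-decay step of
localisation theory. [deps: MobilityGap] [difficulty: L] -/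
@[route_item "route-QuantumFields-GaussianLinkFrames"]
def PhaseQuenchedFlavourDecay : Prop :=
  open MeasureTheory Filter Literature.MathematicalPhysics.QuantumFieldTheory Literature.MathematicalPhysics.QuantumLattice Literature.Probability.LatticeModels in ∀ (Nf : ℕ) (reg : QCDRegularisation Nf) (m : Fin Nf → ℝ), (∀ f, 0 < m f) → (∃ s δ C : ℝ, 0 < s ∧ s < 1 ∧ 0 < δ ∧ ∀ᶠ k in atTop, ∀ S : ℕ, reg.L k ≤ S → ∀ (f : Fin Nf) (v : Literature.Probability.LatticeModels.Site 4), v ∈ box 4 S → (∫ U : GaugeConfig 4 (2 * S + 1) (Matrix.specialUnitaryGroup (Fin 3) ℂ), ‖(diracMatrix U fun fl => reg.mcrit k + reg.a k * m fl / reg.Zm k).det‖ * (∑ a : Fin 3, ∑ i : Fin 4, ∑ b : Fin 3, ∑ j : Fin 4, ‖(diracMatrix U fun fl => reg.mcrit k + reg.a k * m fl / reg.Zm k)⁻¹ (quarkEquiv (f, (Torus.proj (2 * S + 1) 0, a, i))) (quarkEquiv (f, (Torus.proj (2 * S + 1) (v), b, j)))‖) ^ s ∂(wilsonMeasure (fundamentalRep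 (Fin 3)) (reg.β k))) / (∫ U : GaugeConfig 4 (2 * S + 1) (Matrix.specialUnitaryGroup (Fin 3) ℂ), ‖(diracMatrix U fun fl => reg.mcrit k + reg.a k * m fl / reg.Zm k).det‖ ∂(wilsonMeasure (fundamentalRep (Fin 3)) (reg.β k))) ≤ C * Real.exp (-(δ * (reg.a k * ‖v‖)))) → (∃ δ' : ℝ, 0 < δ' ∧ ∀ (R R' : ℕ) (A : QCDLatticeObservable Nf R) (B : QCDLatticeObservable Nf R'), (∃ (f₀ : Fin Nf) (q : ℤ), q ≠ 0 ∧ ∀ (θ : ℝ) (U : LGConfig 4 (Matrix.specialUnitaryGroup (Fin 3) ℂ)), ExteriorAlgebra.map (LinearMap.pi fun w => (Sum.elim (fun i => if (boxQuarkEquiv.symm i).1 = f₀ then Complex.exp (-((θ : ℂ) * Complex.I)) else 1) (fun i => if (boxQuarkEquiv.symm i).1 = f₀ then Complex.exp ((θ : ℂ) * Complex.I) else 1) (ofLex w)) • LinearMap.proj w) (A.F U) = Complex.exp (((q : ℝ) * θ : ℝ) * Complex.I) • A.F U) → ∃ C' : ℝ, ∀ᶠ k in atTop, ∀ S : ℕ,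 reg.L k ≤ S → ∀ n : ℕ, n ≤ S → ‖(∫ U : GaugeConfig 4 (2 * S + 1) (Matrix.specialUnitaryGroup (Fin 3) ℂ), (‖(diracMatrix U fun fl => reg.mcrit k + reg.a k * m fl / reg.Zm k).det‖ : ℂ) * (fermiIntegral (A.onTorus (2 * S + 1) 0 U * B.onTorus (2 * S + 1) (Pi.single 0 (n : ℤ)) U * fermiBoltzmann U fun fl => reg.mcrit k + reg.a k * m fl / reg.Zm k) / fermiIntegral (fermiBoltzmann U fun fl => reg.mcrit k + reg.a k * m fl / reg.Zm k)) ∂(wilsonMeasure (fundamentalRep (Fin 3)) (reg.β k))) / (∫ U : GaugeConfig 4 (2 * S + 1) (Matrix.specialUnitaryGroup (Fin 3) ℂ), (‖(diracMatrix U fun fl => reg.mcrit k + reg.a k * m fl / reg.Zm k).det‖ : ℂ) ∂(wilsonMeasure (fundamentalRep (Fin 3)) (reg.β k)))‖ ≤ C' * Real.exp (-(δ' * (reg.a k * n))))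

/-- item stmt-QuantumFields-17498 · crux · rank 6 · open · by planner
why it might fail: Contains the Yang–Mills gap: sign coherence only at side 2L_k+1 while HasLatticeMassGap needs all S ≥ L_k ⇒ a convergent sign-defect expansion = uniform gluonic clustering at weak coupling, open; plus E0–E4 and non-Gaussian glue. The frame disintegration does not touch this node.
sources: JaffeWitten2000, Balaban1988Convergent, OsterwalderSeiler1978, Luscher1977, MohlerSchaefer2020, SeilerLNP1982
[crux] K3 with the chiral pin as INPUT (statement re-type p117723). For N_f ∈ {2,3}: if some reg :
QCDRegularisation N_f has HasMassScaling, reg.IsChiralAtZero, asymptotic scaling and, for every m >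
0, clauses (i)–(iv) of (Chiral)MobilityGap together with the conclusion of PhaseQuenchedFlavourDecay
(flavour-charged phase-quenched decay at rate δ' a_k), then QCDOf N_f holds — i.e. such a CHIRAL,
localised, sign-coherent, flavour-gapped Wilson trajectory can be completed to OS data with
IsQCDAlong, non-trivial non-Gaussian glue, non-decoupled flavour-changing pseudoscalars,
T.HasMassGap Δ and the FULL HasLatticeMassGap Δ for every m > 0, by a witness regularisation that is
itself chiral at zero: the completion may choose z, shift (IsChiralAtZero reads reg.scheme m 0 0
only), keep reg, or pass to a subsequence retaining the chiral witnesses (countably many (ε_j, m_j),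
diagonal choice), but may NO LONGER shift the flavour-blind offset; the signed weight (dilute
sign-defect gas, reweighting ⟨·σ⟩_{|w|}/⟨σ⟩_{|w|}), the flavour-NEUTRAL and gluonic channels
(hairpins, glueballs) and the continuum limit are its content. Text = GluonicCompletion's with
`reg.IsChiralAtZero ∧` inserted after `r -/
@[route_item "route-QuantumFields-GaussianLinkFrames"]
def ChiralGluonicCompletion : Prop :=
  open MeasureTheory Filter Literature.MathematicalPhysics.QuantumFieldTheory Literature.MathematicalPhysics.QuantumLattice Literature.Probability.LatticeModels in ∀ Nf : ℕ, Nf = 2 ∨ Nf = 3 → (∃ reg : QCDRegularisation Nf, reg.HasMassScaling ∧ reg.IsChiralAtZero ∧ (reg.scheme 0 0 0).HasAsymptoticScaling ∧ ∀ m : Fin Nf → ℝ, (∀ f, 0 < m f) → ((∀ f : Fin Nf, ∀ᶠ k in atTop, -1 < reg.mcrit k + reg.a k * m f / reg.Zm k) ∧ (∃ s δ C : ℝ, 0 < s ∧ s < 1 ∧ 0 < δ ∧ ∀ᶠ k in atTop, ∀ S : ℕ, reg.L k ≤ S → ∀ (f : Fin Nf) (v : Literature.Probability.LatticeModels.Site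 4), v ∈ box 4 S → (∫ U : GaugeConfig 4 (2 * S + 1) (Matrix.specialUnitaryGroup (Fin 3) ℂ), ‖(diracMatrix U fun fl => reg.mcrit k + reg.a k * m fl / reg.Zm k).det‖ * (∑ a : Fin 3, ∑ i : Fin 4, ∑ b : Fin 3, ∑ j : Fin 4, ‖(diracMatrix U fun fl => reg.mcrit k + reg.a k * m fl / reg.Zm k)⁻¹ (quarkEquiv (f, (Torus.proj (2 * S + 1) 0, a, i))) (quarkEquiv (f, (Torus.proj (2 * S + 1) (v), b, j)))‖) ^ s ∂(wilsonMeasure (fundamentalRep (Fin 3)) (reg.β k))) / (∫ U : GaugeConfig 4 (2 * S + 1) (Matrix.specialUnitaryGroup (Fin 3) ℂ), ‖(diracMatrix U fun fl => reg.mcrit k + reg.a k * m fl / reg.Zm k).det‖ ∂(wilsonMeasure (fundamentalRep (Fin 3)) (reg.β k))) ≤ C * Real.exp (-(δ * (reg.a k * ‖v‖)))) ∧ (∃ s c₀ C₁ p : ℝ, 0 < s ∧ s < 1 ∧ 0 < c₀ ∧ ∀ᶠ k in atTop, ∀ S : ℕ, reg.L k ≤ S → ∀ (f : Fin Nf) (n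 : ℕ), n ≤ S → c₀ * Real.exp (-(C₁ * (reg.a k * n) + p * Real.log (n + 1))) ≤ (∫ U : GaugeConfig 4 (2 * S + 1) (Matrix.specialUnitaryGroup (Fin 3) ℂ), ‖(diracMatrix U fun fl => reg.mcrit k + reg.a k * m fl / reg.Zm k).det‖ * (∑ a : Fin 3, ∑ i : Fin 4, ∑ b : Fin 3, ∑ j : Fin 4, ‖(diracMatrix U fun fl => reg.mcrit k + reg.a k * m fl / reg.Zm k)⁻¹ (quarkEquiv (f, (Torus.proj (2 * S + 1) 0, a, i))) (quarkEquiv (f, (Torus.proj (2 * S + 1) (Pi.single 0 (n : ℤ)), b, j)))‖) ^ s ∂(wilsonMeasure (fundamentalRep (Fin 3)) (reg.β k))) / (∫ U : GaugeConfig 4 (2 * S + 1) (Matrix.specialUnitaryGroup (Fin 3) ℂ), ‖(diracMatrix U fun fl => reg.mcrit k + reg.a k * m fl / reg.Zm k).det‖ ∂(wilsonMeasure (fundamentalRep (Fin 3)) (reg.β k)))) ∧ (∀ᶠ k in atTop, (1 / 2 : ℝ) ≤ ‖∫ U : GaugeConfig 4 (2 * reg.L k + 1) (Matrix.specialUnitaryGroup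 (Fin 3) ℂ), (diracMatrix U fun fl => reg.mcrit k + reg.a k * m fl / reg.Zm k).det ∂(wilsonMeasure (fundamentalRep (Fin 3)) (reg.β k))‖ / (∫ U : GaugeConfig 4 (2 * reg.L k + 1) (Matrix.specialUnitaryGroup (Fin 3) ℂ), ‖(diracMatrix U fun fl => reg.mcrit k + reg.a k * m fl / reg.Zm k).det‖ ∂(wilsonMeasure (fundamentalRep (Fin 3)) (reg.β k))))) ∧ (∃ δ' : ℝ, 0 < δ' ∧ ∀ (R R' : ℕ) (A : QCDLatticeObservable Nf R) (B : QCDLatticeObservable Nf R'), (∃ (f₀ : Fin Nf) (q : ℤ), q ≠ 0 ∧ ∀ (θ : ℝ) (U : LGConfig 4 (Matrix.specialUnitaryGroup (Fin 3) ℂ)), ExteriorAlgebra.map (LinearMap.pi fun w => (Sum.elim (fun i => if (boxQuarkEquiv.symm i).1 = f₀ then Complex.exp (-((θ : ℂ) * Complex.I)) else 1) (fun i => if (boxQuarkEquiv.symm i).1 = f₀ then Complex.exp ((θ : ℂ) * Complex.I) else 1) (ofLex w)) • LinearMap.proj w) (A.F U) = Complex.exp (((q : ℝ) * θ : ℝ)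 * Complex.I) • A.F U) → ∃ C' : ℝ, ∀ᶠ k in atTop, ∀ S : ℕ, reg.L k ≤ S → ∀ n : ℕ, n ≤ S → ‖(∫ U : GaugeConfig 4 (2 * S + 1) (Matrix.specialUnitaryGroup (Fin 3) ℂ), (‖(diracMatrix U fun fl => reg.mcrit k + reg.a k * m fl / reg.Zm k).det‖ : ℂ) * (fermiIntegral (A.onTorus (2 * S + 1) 0 U * B.onTorus (2 * S + 1) (Pi.single 0 (n : ℤ)) U * fermiBoltzmann U fun fl => reg.mcrit k + reg.a k * m fl / reg.Zm k) / fermiIntegral (fermiBoltzmann U fun fl => reg.mcrit k + reg.a k * m fl / reg.Zm k)) ∂(wilsonMeasure (fundamentalRep (Fin 3)) (reg.β k))) / (∫ U : GaugeConfig 4 (2 * S + 1) (Matrix.specialUnitaryGroup (Fin 3) ℂ), (‖(diracMatrix U fun fl => reg.mcrit k + reg.a k * m fl / reg.Zm k).det‖ : ℂ) ∂(wilsonMeasure (fundamentalRep (Fin 3)) (reg.β k)))‖ ≤ C' * Real.exp (-(δ' * (reg.a k * n))))) → QCDOf Nf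

/-- item stmt-QuantumFields-17376 · support · rank 9 · closed · proved by Summit.QuantumFields.QCD.Theorems.GaussianLinkFramesPlaquetteGaussianFrame.plaquetteGaussianFrame_proof (prover) · by planner
sources: VairinhosDeforcrand2014, Creutz2022
[support] the one-plaquette Hubbard–Stratonovich identity behind the lever (provable now: three
Gaussian integrals over M₃(ℂ) ≅ ℝ¹⁸, completing squares and ‖A‖² = 3 for A ∈ SU(3)): for every β ≥ 0
there is K(β) > 0 with exp(β Re tr(U_aU_bU_c⁻¹U_d⁻¹)) = K ∫dΦ dΨ dΨ' exp(−(1+2t)‖Φ‖² − ‖Ψ‖² − ‖Ψ'‖²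
+ 2c[Re tr(Ψ†U_a) + Re tr(U_bΦΨ) + Re tr(U_cΦΨ') + Re tr(Ψ'†U_d)]), t = √(β/2), c = √t, for all
U_a,…,U_d ∈ SU(3) — every link linear, every exponent real. Over the torus (Fubini) this makes
Wilson(β) the aux-mixture of the product laws ⊗_e ν_(J_e(aux)), J_e a sum over the 6 plaquettes
through e of 2cΨ, 2c(ΦΨ)†, …. [difficulty: provable-now] -/
@[route_item "route-QuantumFields-GaussianLinkFrames"]
def PlaquetteGaussianFrame : Prop :=
  open MeasureTheory Filter Literature.MathematicalPhysics.QuantumFieldTheory Literature.MathematicalPhysics.QuantumLattice Literature.Probability.LatticeModels in ∀ β : ℝ, 0 ≤ β → ∃ K : ℝ, 0 < K ∧ ∀ Ua Ub Uc Ud : Matrix.specialUnitaryGroup (Fin 3) ℂ, let t : ℝ := Real.sqrt (β / 2); let c : ℝ := Real.sqrt t; let A : Matrix (Fin 3) (Fin 3) ℂ := (Ua : Matrix (Fin 3) (Fin 3) ℂ); let Bm : Matrix (Fin 3) (Fin 3) ℂ := (Ub : Matrix (Fin 3) (Fin 3) ℂ); let Cm : Matrix (Fin 3) (Fin 3) ℂ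 := (Uc : Matrix (Fin 3) (Fin 3) ℂ); let Dm : Matrix (Fin 3) (Fin 3) ℂ := (Ud : Matrix (Fin 3) (Fin 3) ℂ); Real.exp (β * (((Ua * Ub * Uc⁻¹ * Ud⁻¹ : Matrix.specialUnitaryGroup (Fin 3) ℂ) : Matrix (Fin 3) (Fin 3) ℂ)).trace.re) = K * ∫ Φf : Fin 3 → Fin 3 → ℂ, ∫ Ψf : Fin 3 → Fin 3 → ℂ, ∫ Ψ'f : Fin 3 → Fin 3 → ℂ, (let Φ : Matrix (Fin 3) (Fin 3) ℂ := Matrix.of Φf; let Ψ : Matrix (Fin 3) (Fin 3) ℂ := Matrix.of Ψf; let Ψ' : Matrix (Fin 3) (Fin 3) ℂ := Matrix.of Ψ'f; Real.exp (-((1 + 2 * t) * (Φᴴ * Φ).trace.re) - (Ψᴴ * Ψ).trace.re - (Ψ'ᴴ * Ψ').trace.re + 2 * c * ((Ψᴴ * A).trace.re + (Bm * Φ * Ψ).trace.re + (Cm * Φ * Ψ').trace.re + (Ψ'ᴴ * Dm).trace.re)))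

-- `PlaquetteGaussianFrame` holds: proved by `Summit.QuantumFields.QCD.Theorems.GaussianLinkFramesPlaquetteGaussianFrame.plaquetteGaussianFrame_proof` (its module imports this route file, so no `_holds` link can be stated here).

/-- item stmt-QuantumFields-17377 · support · rank 9 · closed · proved by Summit.QuantumFields.QCD.Theorems.GaussianLinkFramesTiltedHaarFlatness.tiltedHaarFlatness_proof (prover) · by planner
sources: VairinhosDeforcrand2014, Creutz2022, AizenmanMolchanov1993
[support] single-link flatness of the tilted-Haar (von Mises–Fisher) law (provable now, Laplace
lower bound on SU(3) via Haar small balls): there are C, p with e^(Re tr U₀J†) ≤ C(1+B)^p ∫ e^(Re tr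
UJ†) dHaar(U) for every J with entries ≤ B and every U₀ ∈ SU(3) — the density of ν_J w.r.t. Haar is
at most polynomial in the tilt, which is what makes the frame's single-link laws "regular" in the
sense of the fractional-moment method with constants (1+B)^p. [difficulty: provable-now] -/
@[route_item "route-QuantumFields-GaussianLinkFrames"]
def TiltedHaarFlatness : Prop :=
  open MeasureTheory Filter Literature.MathematicalPhysics.QuantumFieldTheory Literature.MathematicalPhysics.QuantumLattice Literature.Probability.LatticeModels in ∃ C p : ℝ, 0 < C ∧ ∀ B : ℝ, 0 ≤ B → ∀ J : Matrix (Fin 3) (Fin 3) ℂ, (∀ i j, ‖J i j‖ ≤ B) → ∀ U₀ : Matrix.specialUnitaryGroup (Fin 3) ℂ, Real.exp (((U₀ : Matrix (Fin 3) (Fin 3) ℂ) * Jᴴ).trace.re) ≤ C * (1 + B) ^ p * ∫ U, Real.exp (((U : Matrix (Fin 3) (Fin 3) ℂ) * Jᴴ).trace.re) ∂(haarProbability (Matrix.specialUnitaryGroup (Fin 3) ℂ))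

-- `TiltedHaarFlatness` holds: proved by `Summit.QuantumFields.QCD.Theorems.GaussianLinkFramesTiltedHaarFlatness.tiltedHaarFlatness_proof` (its module imports this route file, so no `_holds` link can be stated here).

/-- item stmt-QuantumFields-17378 · assembly · rank 1 · closed · proved by Summit.QuantumFields.QCD.Theorems.gaussianLinkFrames_assembly_proof (prover) · by planner
sources: JaffeWitten2000, AizenmanEtAl2001, VairinhosDeforcrand2014
[assembly] FrameAPrioriBound → FrameFMClosure → ChiralOneScaleTrajectory → PhaseQuenchedFlavourDecay
→ ChiralGluonicCompletion → QCD -/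
@[route_item "route-QuantumFields-GaussianLinkFrames"]
def Assembly : Prop :=
  FrameAPrioriBound → FrameFMClosure → ChiralOneScaleTrajectory → PhaseQuenchedFlavourDecay → ChiralGluonicCompletion → QCD

-- `Assembly` holds: proved by `Summit.QuantumFields.QCD.Theorems.gaussianLinkFrames_assembly_proof` (its module imports this route file, so no `_holds` link can be stated here).

/-! D-0027 §2.1 — DECIDING THEOREM (planner-authored via `route open/edit --closes-file`; by planner-plan-novel-QuantumFields-QCD-829546d5-v2-g18-0 2026-08-17T01:53:25Z):
its hypotheses are this route's items and its conclusion the sub-problem Statement (glue_lint), and it elaborates with this file. -/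

@[closes "route-QuantumFields-GaussianLinkFrames"] theorem closes (h₁ : FrameAPrioriBound) (h₂ : FrameFMClosure) (h₃ : ChiralOneScaleTrajectory)
    (h₄ : PhaseQuenchedFlavourDecay) (h₅ : ChiralGluonicCompletion) : QCD := by
  have key : ∀ Nf : ℕ, Nf = 2 ∨ Nf = 3 → QCDOf Nf := by
    intro Nf hNf
    obtain ⟨reg, hMS, hCh, hAS, h⟩ := h₃ Nf hNf
    refine h₅ Nf hNf ⟨reg, hMS, hCh, hAS, fun m hm => ?_⟩
    obtain ⟨hi, hin, hiii, hiv⟩ := h m hm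
    have hii := h₂ h₁ Nf reg m hm hin
    exact ⟨⟨hi, hii, hiii, hiv⟩, h₄ Nf reg m hm hii⟩
  exact ⟨key 2 (Or.inl rfl), key 3 (Or.inr rfl)⟩

end Summit.QuantumFields.QCD.Theses.GaussianLinkFrames
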